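import Summits.NavierStokesRegularity.NavierStokesRegularity.Theorems.QuantisedSymmetryPolyhedralTruncationBridge
import Summits.NavierStokesRegularity.NavierStokesRegularity.Theorems.QuantisedSymmetryPolyhedralDssProfileExistsDominatesBlowupProfile
import Summits.NavierStokesRegularity.NavierStokesRegularity.Theorems.QuantisedSymmetryLiouvilleKillsProfile
import Summits.NavierStokesRegularity.NavierStokesRegularity.Theorems.DssFarFieldSlavingDssTruncationBridge
import Summits.NavierStokesRegularity.NavierStokesRegularity.Theses.AncientHullSteering
import Literature.Analysis.FluidPDE.HyperbolicDSSOrbit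
import HarnessLib

/-!
# Strategist companion sketch (cstrat s19-g20) for crux `PolyhedralDssProfileExists` (stmt-1404)

Typed record of the STRATEGY CENSUS `STRATEGY-CENSUS-s19.md`: every `theorem` below is kernel-checked
(no `sorry`); the `def`s are the candidate replacement statements the census examines and rejects.

* §0 `crux_decides` — the crux ALONE proves `¬ NavierStokesRegularity` today (both co-hypotheses of the
  route's `closes` are landed theorems), so any sufficient intermediate decides the summit too.
* §1 weaker intermediates by name: `crux_imp_W1` / `W1_decides` (stmt-0155, drop `G`: still decides `¬S`
  by landed glue), `crux_imp_W1''` / `W1''_decides_given_bridge` (stmt-20186, drop DSS as well: decides `¬S`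
  only through the OPEN bridge stmt-20185).
* §2 the best typed split (bridge split `T ∧ (T → X)`): `PolyhedralTypeIAncientExists`, `ClosingLemma`,
  `crux_of_split` (assembly = modus ponens, proved), `split_T_of_crux` (X → T), and the obstruction statement
  `RdssDetuningExcluded` (why the RSS filament engine of FilamentSkeletonRss cannot be borrowed).
* §3 the strengthening `HyperbolicPolyhedralProfileExists` (S⁺) with `crux_of_hyperbolic` (S⁺ → X proved).
* §4 negation side: `not_crux_of_liouville` (= landed support `LiouvilleKillsProfile`).
-/

set_option linter.dupNamespace false

namespace Summit.NavierStokesRegularity.NavierStokesRegularity.Cruxes.PolyhedralDssProfileExists.StrategistS19g20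

open MeasureTheory
open Literature.Analysis.FluidPDE
open _root_.Summit.NavierStokesRegularity.NavierStokesRegularity.Theses

/-! ## §0 The crux alone decides the summit -/

/-- The crux alone refutes Clay (A): both other binders of `QuantisedSymmetry.closes` are landed theorems
(`quantisedSymmetry_polyhedralTruncationBridge_proof`, stmt-11331; `ClayUniqueness_holds`, stmt-0153). -/
theorem crux_decides (hX : QuantisedSymmetry.PolyhedralDssProfileExists) : ¬ _root_.NavierStokesRegularity :=
  QuantisedSymmetry.closes hX
    _root_.Summit.NavierStokesRegularity.NavierStokesRegularity.Theorems.quantisedSymmetry_polyhedralTruncationBridge_proof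
    QuantisedSymmetry.ClayUniqueness_holds

/-! ## §1 Weaker intermediates (by name, all in tree) -/

/-- W1 = stmt-0155 (`BlowupTypeIDssProfile`, the `G`-free version): the crux implies it (landed stub
`stub_dominatesBlowupProfile`; `Blowup.BlowupTypeIDssProfile` and `DssFarFieldSlaving.BlowupTypeIDssProfile`
are the same term). -/
theorem crux_imp_W1 (hX : QuantisedSymmetry.PolyhedralDssProfileExists) :
    DssFarFieldSlaving.BlowupTypeIDssProfile :=
  _root_.Summit.NavierStokesRegularity.NavierStokesRegularity.Theorems.PolyhedralDssProfileExists.PolyhedralCell.stub_dominatesBlowupProfile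
    hX

/-- … and W1 ALSO decides the summit on landed theorems alone (`DssFarFieldSlaving.closes` with the proved
bridge `dssTruncationBridge_proof`, stmt-14477): replacing the crux by W1 is a supersede into route
DssFarFieldSlaving, not a strategy short of the summit. -/
theorem W1_decides (hW : DssFarFieldSlaving.BlowupTypeIDssProfile) : ¬ _root_.NavierStokesRegularity :=
  DssFarFieldSlaving.closes
    _root_.Summit.NavierStokesRegularity.NavierStokesRegularity.Theorems.dssTruncationBridge_proof hW

/-- W1'' = stmt-20186 (`SelfExcitedTypeIProfile`: a nontrivial BOUNDED ancient mild solution with Type-I decay,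
no self-similarity, no symmetry): the crux implies it, via the landed support `LiouvilleKillsProfile`
(`¬W1'' ⇒ PolyhedralTypeILiouville ⇒ ¬X`). -/
theorem crux_imp_W1'' (hX : QuantisedSymmetry.PolyhedralDssProfileExists) :
    AncientHullSteering.SelfExcitedTypeIProfile := by
  intro hL
  have h3 : QuantisedSymmetry.PolyhedralTypeILiouville :=
    fun G _ _ _ u hu hmeas hdec _ => hL u hu hmeas hdec
  exact _root_.Summit.NavierStokesRegularity.NavierStokesRegularity.Theorems.quantisedSymmetry_liouvilleKillsProfile_proof
    h3 hX

/-- … but W1'' decides the summit only THROUGH the open bridge stmt-20185 (`AncientTruncationBridge`, XL,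
"Sacker–Sell gap may not exist"): trading the crux for W1'' moves the whole difficulty into an unbuilt
bridge plus a KNSS-hard existence statement (route AncientHullSteering already owns exactly this pair). -/
theorem W1''_decides_given_bridge (hR : AncientHullSteering.AncientTruncationBridge)
    (hP : AncientHullSteering.SelfExcitedTypeIProfile) : ¬ _root_.NavierStokesRegularity :=
  AncientHullSteering.closes hR hP

/-! ## §2 Decomposition attempt: the bridge split `T ∧ (T → X)` -/

/-- Piece `T` (open, substantive): a nontrivial ancient mild solution with Type-I space–time decay which is
equivariant under a finite irreducible rotation group — the crux with the DSS clause DELETED. -/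
def PolyhedralTypeIAncientExists : Prop :=
  ∃ G : Subgroup (EuclideanSpace ℝ (Fin 3) ≃ₗᵢ[ℝ] EuclideanSpace ℝ (Fin 3)), Finite G ∧
    (∀ g ∈ G, LinearMap.det (g.toLinearEquiv : EuclideanSpace ℝ (Fin 3) →ₗ[ℝ] EuclideanSpace ℝ (Fin 3)) = 1) ∧
    (∀ V : Submodule ℝ (EuclideanSpace ℝ (Fin 3)), (∀ g ∈ G, ∀ v ∈ V, g v ∈ V) → V = ⊥ ∨ V = ⊤) ∧
    ∃ u : ℝ → EuclideanSpace ℝ (Fin 3) → EuclideanSpace ℝ (Fin 3),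
      IsAncientMildSolution 1 u ∧ (∀ t < 0, AEStronglyMeasurable (u t) volume) ∧
      (∃ C₀ : ℝ, HasTypeIDecay C₀ u) ∧ (∀ g ∈ G, ∀ t x, u t (g x) = g (u t x)) ∧
      ¬ (∀ t < 0, u t =ᵐ[volume] 0)

/-- Piece `T → X` ("closing lemma": from SOME polyhedral Type-I ancient solution manufacture a DISCRETELY
SELF-SIMILAR one — e.g. by a recurrence / ω-limit argument for the similarity flow on the compact hull of the
orbit). No mechanism in print; the similarity flow is not gradient-like and has no closing lemma. -/
def ClosingLemma : Prop :=
  PolyhedralTypeIAncientExists → QuantisedSymmetry.PolyhedralDssProfileExists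

/-- Assembly of the split (modus ponens) — proved, so (b) of the redirect test holds trivially
(`trivial_seam`); the split fails (d): neither piece has a plan, and `T` is KNSS-hard. -/
theorem crux_of_split (hT : PolyhedralTypeIAncientExists) (hC : ClosingLemma) :
    QuantisedSymmetry.PolyhedralDssProfileExists :=
  hC hT

/-- The converse direction of the seam: the crux gives `T` for free (drop the DSS clause). -/
theorem split_T_of_crux (hX : QuantisedSymmetry.PolyhedralDssProfileExists) : PolyhedralTypeIAncientExists := by
  obtain ⟨G, hfin, hdet, hirr, c, -, u, hanc, hmeas, -, hdec, heqv, hnt⟩ := hX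
  exact ⟨G, hfin, hdet, hirr, u, hanc, hmeas, hdec, heqv, hnt⟩

/-- OBSTRUCTION to borrowing the rotated-self-similar (RSS/RDSS) filament engine of route FilamentSkeletonRss
(which needs a rotation part `α ≠ 0` "to all orders"): a profile equivariant under a finite IRREDUCIBLE rotation
group admits no genuine rotational detuning — if `u` is `G`-equivariant and `(c, R)`-RDSS then the closed group
of its scaling–rotation symmetries contains `G` and `R G R⁻¹`; for `R ∉ N(G)` that forces `SO(3)`-equivariant
slices (closed subgroups of `SO(3)` strictly above `O`/`I`, or above `T` and not inside `O`, are dense), hence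
radial divergence-free slices, hence triviality; for `R ∈ N(G)` one has `R² ∈ G` (`N(T) = O`, `N(O) = O`,
`N(I) = I` in `SO(3)`), so `u` is plainly `c²`-DSS. Recorded as a statement (support-grade, not filed). -/
def RdssDetuningExcluded : Prop :=
  ∀ G : Subgroup (EuclideanSpace ℝ (Fin 3) ≃ₗᵢ[ℝ] EuclideanSpace ℝ (Fin 3)), Finite G →
    (∀ g ∈ G, LinearMap.det (g.toLinearEquiv : EuclideanSpace ℝ (Fin 3) →ₗ[ℝ] EuclideanSpace ℝ (Fin 3)) = 1) →
    (∀ V : Submodule ℝ (EuclideanSpace ℝ (Fin 3)), (∀ g ∈ G, ∀ v ∈ V, g v ∈ V) → V = ⊥ ∨ V = ⊤) →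
    ∀ (c : ℝ) (R : EuclideanSpace ℝ (Fin 3) ≃ₗᵢ[ℝ] EuclideanSpace ℝ (Fin 3))
      (u : ℝ → EuclideanSpace ℝ (Fin 3) → EuclideanSpace ℝ (Fin 3)), 1 < c →
      IsAncientMildSolution 1 u → (∀ t < 0, AEStronglyMeasurable (u t) volume) →
      IsRotatedDSS c R u → (∀ g ∈ G, ∀ t x, u t (g x) = g (u t x)) →
      IsDiscretelySelfSimilar (c ^ 2) u ∨ (∀ t < 0, u t =ᵐ[volume] 0)

/-! ## §3 Strengthening attempt: the hyperbolic profile S⁺ -/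

/-- S⁺: a polyhedrally equivariant Type-I `c`-DSS profile whose similarity orbit is HYPERBOLIC modulo the
symmetry modes (`IsHyperbolicTypeIDSSOrbit`, the DssFarFieldSlaving notion, with trivial rotation part).
The added rigidity is what a Newton–Kantorovich / computer-assisted existence proof would certify AS A
BY-PRODUCT — it buys nothing before a numerical candidate exists. -/
def HyperbolicPolyhedralProfileExists : Prop :=
  ∃ G : Subgroup (EuclideanSpace ℝ (Fin 3) ≃ₗᵢ[ℝ] EuclideanSpace ℝ (Fin 3)), Finite G ∧
    (∀ g ∈ G, LinearMap.det (g.toLinearEquiv : EuclideanSpace ℝ (Fin 3) →ₗ[ℝ] EuclideanSpace ℝ (Fin 3)) = 1) ∧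
    (∀ V : Submodule ℝ (EuclideanSpace ℝ (Fin 3)), (∀ g ∈ G, ∀ v ∈ V, g v ∈ V) → V = ⊥ ∨ V = ⊤) ∧
    ∃ c : ℝ, ∃ u : ℝ → EuclideanSpace ℝ (Fin 3) → EuclideanSpace ℝ (Fin 3),
      IsHyperbolicTypeIDSSOrbit c (LinearIsometryEquiv.refl ℝ (EuclideanSpace ℝ (Fin 3))) u ∧
      (∀ g ∈ G, ∀ t x, u t (g x) = g (u t x))

/-- S⁺ → X (routine projection: hyperbolic orbit ⇒ Type-I DSS profile; `IsRotatedDSS c refl = IsDSS c`). -/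
theorem crux_of_hyperbolic (h : HyperbolicPolyhedralProfileExists) :
    QuantisedSymmetry.PolyhedralDssProfileExists := by
  obtain ⟨G, hfin, hdet, hirr, c, u, hH, heqv⟩ := h
  have hP := hH.toIsTypeIDSSProfile
  exact ⟨G, hfin, hdet, hirr, c, hP.one_lt, u, hP.isAncientMildSolution, hP.aestronglyMeasurable,
    isRotatedDSS_refl_iff.1 hP.isRotatedDSS, hP.hasTypeIDecay, heqv, hP.nontrivial⟩

/-! ## §4 Negation side (kill switch, landed glue) -/

/-- The negation of the crux follows from the polyhedral bounded Type-I Liouville theorem stmt-1405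
(landed support `LiouvilleKillsProfile`); stmt-1405 is the T/O/I case of the KNSS Liouville conjecture with
Type-I decay — no engine (census §Negation). -/
theorem not_crux_of_liouville (h3 : QuantisedSymmetry.PolyhedralTypeILiouville) :
    ¬ QuantisedSymmetry.PolyhedralDssProfileExists :=
  _root_.Summit.NavierStokesRegularity.NavierStokesRegularity.Theorems.quantisedSymmetry_liouvilleKillsProfile_proof h3

end Summit.NavierStokesRegularity.NavierStokesRegularity.Cruxes.PolyhedralDssProfileExists.StrategistS19g20
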